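import Summits.BirchSwinnertonDyer.BirchSwinnertonDyer.Theorems.PrintX10bUpperLinkRoad
import Summits.BirchSwinnertonDyer.BirchSwinnertonDyer.Theorems.PrintX10bBeyondCarrierUpperLinkOfPrint
import Summits.BirchSwinnertonDyer.BirchSwinnertonDyer.Theorems.PrintX9HeegnerDivisibility
import Summits.BirchSwinnertonDyer.BirchSwinnertonDyer.Theorems.KolyvaginRoadThreeTowerFormPrintFree
import Literature.NumberTheory.EllipticCurves.BSDSelmerCMPConverseHeegnerFieldProofs
import Summits.BirchSwinnertonDyer.BirchSwinnertonDyer.Theses.PrintX10b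
import HarnessLib

/-!
# `cha-sandwich-mu-x10b` — the PARTNER LOCUS composition, kernel-checked (rev 5a; memo DESKCHECK §13.1)

Seat bsd-idea-5 g7 (D-0145 ideator, lens «transfer»). PUBLISH-ONLY (W-79): not registered, no `skeleton check`; NO `sorry`.
BSD is not proved by any of this; no crux is closed by this file.

What is checked here: on the PARTNER LOCUS `PartnerLocusX10b` (frames `(E, K)` carrying a mod-`p` congruent partner `A/ℚ`,
Heegner for `K`, whose anticyclotomic BDP Selmer dual is finitely generated over `ℤ_p` — (FG)_A), the route's one-sided link
U₃ for `E` (`UpperLinkLightX10bOn PartnerLocusX10b`, the residual stub's currency) follows from exactly two named inputs: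
the K2 support lemma `ResidualMuInvarianceBDP` (typed in `Lines/cha_sandwich_mu_residual_invariance.lean`, elementary, memo §12)
and the DICTIONARY `FGDictionaryX10b` («(FG)_E ⇒ U₃ at the frame»: rational IMC + Castella's value, the cell's lower-link inputs,
memo §9.3 / blueprint §5). The partner side ((FG)_A from §1-for-A + Hsieh Thm B for non-CM `A`, F-b″ for CM `A`) is what puts a
frame into the locus; the seed-degenerate frames (every pool partner has `r_an(A/K) ≥ 3`) are the declared residue R_frame.
-/

set_option autoImplicit false
set_option linter.dupNamespace false

noncomputable section

open scoped Classical MatrixGroups ModularForm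

open CongruenceSubgroup WeierstrassCurve NumberField IsDedekindDomain
  Literature.NumberTheory.EllipticCurves Literature.NumberTheory.EllipticCurves.ModularForms
  Literature.NumberTheory.EllipticCurves.JetchevSkinnerWan2017
  Literature.NumberTheory.EllipticCurves.YanZhu2026
  Summit.BirchSwinnertonDyer.BirchSwinnertonDyer.Theorems.Rank1ResidualX1Defs
  Summit.BirchSwinnertonDyer.Rank1Residual
  Summit.BirchSwinnertonDyer.Rank1Residual.X11b.Three.Koly
  Summit.BirchSwinnertonDyer.Rank1Residual.X11b.KolyvaginBottom
  Summit.BirchSwinnertonDyer.BirchSwinnertonDyer.Rank1Residual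
  Summit.BirchSwinnertonDyer.BirchSwinnertonDyer.Theses.PrintX10b

open Literature.NumberTheory.EllipticCurves.Rank1Residual (ClassX10 Surj Irr Good GoodOrd)

namespace Summit.BirchSwinnertonDyer.BirchSwinnertonDyer.Cruxes.HowardContainmentAnyClassNumberX10b.ChaSandwichMuX10b.PartnerLocus

/-! ## Verbatim copies (the `Cruxes/…/Lines/*.lean` files are standalone, not importable modules): `UpperLinkLightX10bOn` from
 `Lines/cha_sandwich_mu_x10b.lean` (rev 2, 733cc1784f09a395) and `XAcModPFinite` / `ModPCongruentOver` / `ResidualMuInvarianceBDP` from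
 `Lines/cha_sandwich_mu_residual_invariance.lean` (a39aae3b4076206f) — same text, sub-namespace `PartnerLocus`. -/

/-- **U₃ on the light frames satisfying a side condition `S W p K`.** The body is, letter for letter, the
`hU3` binder of the route's leaf theorem `X10.bsdpOnClassX10b_of_upperLink_of_printFacts`
(`Theorems/PrintX10bUpperLinkRoad.lean`), with `S W p K →` inserted after the field binders. -/
def UpperLinkLightX10bOn
    (S : ∀ (W : WeierstrassCurve ℚ) (p : ℕ) (K : Type) [Field K] [NumberField K], Prop) : Prop :=
  ∀ (W : WeierstrassCurve ℚ) [W.IsElliptic] [W.IsGloballyMinimal] (p : ℕ) [Fact p.Prime]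
    [NeZero (W.conductorNorm ℤ)] (K : Type) [Field K] [NumberField K],
    S W p K →
    ClassX10 W p → ¬ Surj W 3 → ¬ W.HasCM → IsImaginaryQuadratic K → Odd (NumberField.discr K) →
    NumberField.discr K ≠ -3 → SatisfiesHeegnerHypothesis (W.conductorNorm ℤ) K →
    SatisfiesHeegnerHypothesis p K → (W.baseChange K).HasIrreducibleModPGaloisRep p →
    ∀ (ι : K →+* ℚ_[p]) (κ : ZpExtension K p), κ.IsAnticyclotomic →
    ∀ (γ : Field.absoluteGaloisGroup K) [Fact (κ.IsTopGenerator γ)]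
      (Dt : ModularParametrizationData W (W.conductorNorm ℤ)), ¬ (p : ℤ) ∣ Dt.c →
    ∀ (H : HeegnerDatum (W.conductorNorm ℤ) (NumberField.discr K)) (ιC : K →+* ℂ)
      (P : (W.baseChange K).toAffine.Point),
      WeierstrassCurve.Affine.Point.map ιC.toRatAlgHom P = heegnerPointComplex Dt H →
      (W.baseChange K).mordellWeilRank = 1 →
      Finite (AddCommGroup.primaryComponent (W.baseChange K).sha p) → ¬ IsOfFinAddOrder P →
    ∃ n : ℕ, X11b.AcSelmer.XAc.HasCharValuationAt (W.baseChange K) p κ (X11b.inducedPlace ι) ∅ γ n ∧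
      (n : ℤ) ≤ 2 * (X11b.padicLogOrd W p ι P + (padicValInt p (1 - W.frobeniusTrace p + p) : ℤ) - 1)


/-- **(FG) typed**: "`X_ac^∅(E[p^∞])` is finitely generated over `ℤ_p`", as finiteness of `X ⧸ pX`
(equivalent by Nakayama for the compact `Λ`-module `X`; it implies `X` is `Λ`-torsion with `μ = 0`). [folklore] -/
def XAcModPFinite {K : Type} [Field K] [NumberField K] (W : WeierstrassCurve K) (p : ℕ) [Fact p.Prime]
    (κ : ZpExtension K p) (𝔭 : HeightOneSpectrum (𝓞 K)) (γ : Field.absoluteGaloisGroup K)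
    [Fact (κ.IsTopGenerator γ)] : Prop :=
  Finite (X11b.AcSelmer.XAc W p κ 𝔭 ∅ γ ⧸
    ((Ideal.span {(p : IwasawaAlgebra p)}) •
      (⊤ : Submodule (IwasawaAlgebra p) (X11b.AcSelmer.XAc W p κ 𝔭 ∅ γ))))

/-- **Mod-`p` congruence over a field `F`**: a `Γ_F`-equivariant isomorphism `E₁[p] ≅ E₂[p]` of the geometric
`p`-torsion (`geomTorsion`, Silverman AEC III.§7). [folklore] -/
def ModPCongruentOver {F : Type} [Field F] (W₁ W₂ : WeierstrassCurve F) (p : ℕ) : Prop :=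
  ∃ e : W₁.geomTorsion p ≃+ W₂.geomTorsion p,
    ∀ (σ : Field.absoluteGaloisGroup F) (P : W₁.geomTorsion p), e (σ • P) = σ • e P

/-- **K2 support lemma — `ResidualMuInvarianceBDP`** (memo §12.1; to be proved, routine): on a JOINT HEEGNER
frame the property "`X_ac` is finitely generated over `ℤ_p`" is an invariant of the residual representation
`ρ̄|G_K`. Binders follow the route's light-frame conventions (`UpperLinkLightX10bOn`): `𝔭 = inducedPlace ι`.
[cite: GreenbergVatsal2000, Prop. 2.8 (the cyclotomic model of the argument)] [cite: arXiv:2302.06553, Thm 1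
(finer λ-statement under (H0), (TR), p ∤ h_K)] -/
def ResidualMuInvarianceBDP : Prop :=
  ∀ (W₁ W₂ : WeierstrassCurve ℚ) [W₁.IsElliptic] [W₂.IsElliptic] [W₁.IsGloballyMinimal]
    [W₂.IsGloballyMinimal] [NeZero (W₁.conductorNorm ℤ)] [NeZero (W₂.conductorNorm ℤ)]
    (p : ℕ) [Fact p.Prime] (K : Type) [Field K] [NumberField K],
    IsImaginaryQuadratic K →
    SatisfiesHeegnerHypothesis (W₁.conductorNorm ℤ) K → SatisfiesHeegnerHypothesis (W₂.conductorNorm ℤ) K →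
    SatisfiesHeegnerHypothesis p K → (W₁.baseChange K).HasIrreducibleModPGaloisRep p →
    ModPCongruentOver (W₁.baseChange K) (W₂.baseChange K) p →
    ∀ (ι : K →+* ℚ_[p]) (κ : ZpExtension K p), κ.IsAnticyclotomic →
    ∀ (γ : Field.absoluteGaloisGroup K) [Fact (κ.IsTopGenerator γ)],
      (XAcModPFinite (W₁.baseChange K) p κ (X11b.inducedPlace ι) γ ↔
        XAcModPFinite (W₂.baseChange K) p κ (X11b.inducedPlace ι) γ)


/-! ## New in rev 5a: the partner locus, the dictionary, the composition -/


/-- **The partner locus** `S_partner(E, p, K)`: some `A/ℚ` with `A[p] ≅ E[p]` over `K`, `K` Heegner for `N_A`, whose `X_ac(A/K_∞)` is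
finitely generated over `ℤ_p` for every anticyclotomic datum `(ι, κ, γ)` ((FG)_A; supplied by §1-for-`A` + the lower link + Hsieh 2014
Thm B when `A` is non-CM, carrier-free and `r_an(A/K) = 1`). [folklore] -/
def PartnerLocusX10b (W : WeierstrassCurve ℚ) (p : ℕ) (K : Type) [Field K] [NumberField K] : Prop :=
  ∃ (A : WeierstrassCurve ℚ) (_ : A.IsElliptic) (_ : A.IsGloballyMinimal) (_ : NeZero (A.conductorNorm ℤ)) (_ : Fact p.Prime),
    SatisfiesHeegnerHypothesis (A.conductorNorm ℤ) K ∧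
    ModPCongruentOver (W.baseChange K) (A.baseChange K) p ∧
    ∀ (ι : K →+* ℚ_[p]) (κ : ZpExtension K p), κ.IsAnticyclotomic →
      ∀ (γ : Field.absoluteGaloisGroup K) [Fact (κ.IsTopGenerator γ)],
        XAcModPFinite (A.baseChange K) p κ (X11b.inducedPlace ι) γ

/-- **The dictionary** «(FG)_E ⇒ U₃ at the frame» on light X10b frames: the binders of `UpperLinkLightX10bOn` with the extra hypothesis
`XAcModPFinite (E_K)`; mathematically: `X/pX` finite ⇒ `X` torsion with `μ = 0` ⇒ (rational IMC `(char X)Λ^ur ⊗ ℚ = (L_𝔭^BDP)`, BCS 1.2.4 (a) /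
YZ 4.12, + Castella's value `ord L_𝔭^BDP(𝟙) = v`) `ord f(0) = v − μ(L) ≤ v`. A support statement for a prover; nothing asserted.
[cite: BurungaleCastellaSkinner2025, Thm. 1.2.4 (a) (arXiv:2405.00270v2 p. 3) (shape only; nothing asserted)]
[cite: Castella2018, Thm. 3.2 (arXiv:1704.06608 p. 9) (shape only; nothing asserted)] -/
def FGDictionaryX10b : Prop :=
  ∀ (W : WeierstrassCurve ℚ) [W.IsElliptic] [W.IsGloballyMinimal] (p : ℕ) [Fact p.Prime]
    [NeZero (W.conductorNorm ℤ)] (K : Type) [Field K] [NumberField K],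
    ClassX10 W p → ¬ Surj W 3 → ¬ W.HasCM → IsImaginaryQuadratic K → Odd (NumberField.discr K) →
    NumberField.discr K ≠ -3 → SatisfiesHeegnerHypothesis (W.conductorNorm ℤ) K →
    SatisfiesHeegnerHypothesis p K → (W.baseChange K).HasIrreducibleModPGaloisRep p →
    ∀ (ι : K →+* ℚ_[p]) (κ : ZpExtension K p), κ.IsAnticyclotomic →
    ∀ (γ : Field.absoluteGaloisGroup K) [Fact (κ.IsTopGenerator γ)],
      XAcModPFinite (W.baseChange K) p κ (X11b.inducedPlace ι) γ → ∀
      (Dt : ModularParametrizationData W (W.conductorNorm ℤ)), ¬ (p : ℤ) ∣ Dt.c →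
    ∀ (H : HeegnerDatum (W.conductorNorm ℤ) (NumberField.discr K)) (ιC : K →+* ℂ)
      (P : (W.baseChange K).toAffine.Point),
      WeierstrassCurve.Affine.Point.map ιC.toRatAlgHom P = heegnerPointComplex Dt H →
      (W.baseChange K).mordellWeilRank = 1 →
      Finite (AddCommGroup.primaryComponent (W.baseChange K).sha p) → ¬ IsOfFinAddOrder P →
    ∃ n : ℕ, X11b.AcSelmer.XAc.HasCharValuationAt (W.baseChange K) p κ (X11b.inducedPlace ι) ∅ γ n ∧
      (n : ℤ) ≤ 2 * (X11b.padicLogOrd W p ι P + (padicValInt p (1 - W.frobeniusTrace p + p) : ℤ) - 1)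


/-- **Composition (kernel-checked, no sorry)**: K2 lemma + dictionary ⇒ U₃ on the partner locus. -/
theorem upperLinkLightX10bOn_partnerLocus (hR : ResidualMuInvarianceBDP) (hD : FGDictionaryX10b) :
    UpperLinkLightX10bOn PartnerLocusX10b := by
  intro W _ _ p _ _ K _ _ hS hX hns hcm hK hodd hd3 hHW hHp hirr ι κ hκ γ _ Dt hDt H ιC P hP hrank hSha hPord
  obtain ⟨A, iA₁, iA₂, iA₃, _, hHA, hcong, hFG⟩ := hS
  have hA : XAcModPFinite (A.baseChange K) p κ (X11b.inducedPlace ι) γ := hFG ι κ hκ γ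
  have hE : XAcModPFinite (W.baseChange K) p κ (X11b.inducedPlace ι) γ :=
    (hR W A p K hK hHW hHA hHp hirr hcong ι κ hκ γ).mpr hA
  exact hD W p K hX hns hcm hK hodd hd3 hHW hHp hirr ι κ hκ γ hE Dt hDt H ιC P hP hrank hSha hPord

end Summit.BirchSwinnertonDyer.BirchSwinnertonDyer.Cruxes.HowardContainmentAnyClassNumberX10b.ChaSandwichMuX10b.PartnerLocus
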